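import Literature.Probability.FitznerVanDerHofstad2017.SrwChatPowSchwinger
import Literature.Probability.FitznerVanDerHofstad2017.SrwAbsCosineDefect
import HarnessLib

/-!
# The axis atoms `K_{n+1,0}(m e_i)` as explicit double integrals over one-coordinate transforms

For simple random walk on `ℤ^d` (cube `[-π,π]^d`, `D̂(k) = d⁻¹Σ_j cos k_j`, `Ĉ = [1 − D̂]⁻¹`,
`D̂^{(x)}` the symmetrised mode) the atoms of the Fitzner–van der Hofstad bounds
[FitznerVanDerHofstad2016NoBLE, (3.34)–(3.36) p. 1071, §5.1.1 (5.2)–(5.4)] at an axis node `x = m e_i`,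
`K_{n+1,0}(m e_i) = ∫ |D̂^{(m e_i)}(k)| Ĉ(k)^{n+1} dk/(2π)^d`, are composed here from

* the cosine-defect formula `srwK_eq_integral_cosDefect_scaled` (`SrwAbsCosineDefect.lean`,
  `|ξ| = (2/π)∫₀^∞(1 − cos(βξ))β⁻²dβ` under the cube integral, scaled by `d`), and
* the one-coordinate factorisation + Schwinger step `integral_one_sub_cos_mul_Chat_pow_succ_single_eq`
  (`SrwChatPowSchwinger.lean`),

into ONE explicit formula whose only inputs are the one-dimensional transforms
`∫_{-π}^{π} e^{(τ/d) cos t} dt = 2π I₀(τ/d)` and `B_m(τ/d, β) = ∫_{-π}^{π} e^{(τ/d) cos t + iβ cos(m t)} dt`: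

`K_{n+1,0}(m e_i) = (2/(πd)) ∫₀^∞ β⁻² · [(n!)⁻¹ ∫₀^∞ τⁿ e^{−τ} ((2πI₀(τ/d))^d − Re B_m(τ/d,β)^d) dτ] /(2π)^d dβ`

for every `d ≥ 2n + 3`, every axis `i` and every `m : ℤ`.  d-generic identity; no number is asserted
(lane: what-if / input-certification support — it names the 2-D integral a certified quadrature of
the axis atoms has to evaluate).
-/

noncomputable section

open MeasureTheory Set Filter Real
open scoped Topology Nat

namespace Literature.Probability.FitznerVanDerHofstad2017

open Literature.Barriers.CriticalPhenomena
open Literature.Barriers.CriticalPhenomena.Slade2006Prop53 (μI P)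

variable {d : ℕ}

/-- **`K_{n+1,0}(m e_i)` via one-coordinate transforms**: composition of
`srwK_eq_integral_cosDefect_scaled` (l = 0) with `integral_one_sub_cos_mul_Chat_pow_succ_single_eq`.
[cite: FitznerVanDerHofstad2016NoBLE, (3.34)–(3.36) p. 1071; FitznerVanDerHofstad2016NoBLE, §5.1.1 (5.2)–(5.4)] -/
theorem srwK_succ_zero_single_eq_integral_axisTransform (n : ℕ) (hd : 2 * (n + 1) + 1 ≤ d)
    (i : Fin d) (m : ℤ) :
    srwK d (n + 1) 0 (Pi.single i m)
      = 2 / (π * d) * ∫ β in Ioi (0:ℝ),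
          ((n ! : ℝ)⁻¹ * (∫ τ in Ioi (0:ℝ), τ ^ n * (Real.exp (-τ) *
            ((∫ t, Real.exp (τ / d * Real.cos t) ∂μI) ^ d
              - ((∫ t, Complex.exp (((τ / d * Real.cos t : ℝ) : ℂ) + ((β * Real.cos (m * t) : ℝ) : ℂ) * Complex.I) ∂μI) ^ d).re)))
            / (2 * π) ^ d) / β ^ 2 := by
  rw [srwK_eq_integral_cosDefect_scaled hd 0 (Pi.single i m)]
  congr 1
  refine setIntegral_congr_fun measurableSet_Ioi fun β _ => ?_
  simp only [pow_zero, one_mul]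
  rw [integral_one_sub_cos_mul_Chat_pow_succ_single_eq n hd]

/-- the same with the `(n!)⁻¹/(2π)^d` and `2/(πd)` constants pulled out of both integrals:
`K_{n+1,0}(m e_i) = (2/(πd))·(n!)⁻¹·(2π)^{−d} ∫₀^∞ (∫₀^∞ τⁿe^{−τ}[(∫e^{(τ/d)cos})^d − Re B_m^d] dτ) β⁻² dβ`.
[cite: FitznerVanDerHofstad2016NoBLE, (3.34)–(3.36) p. 1071] -/
theorem srwK_succ_zero_single_eq_const_mul_integral (n : ℕ) (hd : 2 * (n + 1) + 1 ≤ d)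
    (i : Fin d) (m : ℤ) :
    srwK d (n + 1) 0 (Pi.single i m)
      = 2 / (π * d) * ((n ! : ℝ)⁻¹ / (2 * π) ^ d) * ∫ β in Ioi (0:ℝ),
          (∫ τ in Ioi (0:ℝ), τ ^ n * (Real.exp (-τ) *
            ((∫ t, Real.exp (τ / d * Real.cos t) ∂μI) ^ d
              - ((∫ t, Complex.exp (((τ / d * Real.cos t : ℝ) : ℂ) + ((β * Real.cos (m * t) : ℝ) : ℂ) * Complex.I) ∂μI) ^ d).re)))
            / β ^ 2 := by
  rw [srwK_succ_zero_single_eq_integral_axisTransform n hd i m, mul_assoc,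
    ← integral_const_mul ((n ! : ℝ)⁻¹ / (2 * π) ^ d)]
  congr 1
  refine setIntegral_congr_fun measurableSet_Ioi fun β _ => ?_
  ring

end Literature.Probability.FitznerVanDerHofstad2017

end
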